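import Mathlib
import HarnessLib
import HarnessLib.Audit
import Summits.HodgeConjecture.Statement
import Literature.AlgebraicGeometry.HodgeTheory.HodgeConjecture
import Literature.Geometry.Kaehler.CechDeRham
import Literature.Geometry.Kaehler.HolomorphicLineBundle
import Literature.NumberTheory.Transcendental.FormsAlgebra
import Literature.NumberTheory.Transcendental.ComplexForms
import Summits.HodgeConjecture.HodgeConjecture.Theorems.GenericDivisibilityHodgeModelsExist
import Literature.AlgebraicGeometry.HodgeTheory.HodgeTypeDimension
import HarnessLib.Audit.Status.Attr

/-!
Route: MilnorKExponential

DORMANT since 2026-08-26T14:58:55Z (reconciler: no traction for 6.7 d (last activity item-proof-filed at 2026-08-19T22:25:48Z); parked, not closed — `ledger route dormant route-HodgeConjecture-MilnorKExponential --off` to reactivate) — unstaffed, not closed; items shared with open routes are served there. `ledger route dormant <id> --off` reactivates.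

# Route MilnorKExponential — HC = weight-p exponential sequence (Hodge classes are Milnor-symbol
classes) + Milnor-K GAGA (rational symbol classes are algebraic)

LENS resurrect (2001 route `hodge/analytic-milnor-k-cohomology`, STATUS proving, never refuted;
realises the open idea card
milnor-k-gerbe-exponential). It suffices to show X = GK ∧ LIFT. For a smooth projective X/ℂ and p =
q+1 ≥ 1 call
c ∈ H^{2p}(X(ℂ);ℂ) a SYMBOL CLASS if, on some (normalised) Hodge model X^an, a non-zero integer
multiple of c is the
Čech–de Rham transgression of a Čech p-cocycle of holomorphic Milnor symbols — on each (p+1)-fold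
intersection U_J of a
finite open cover a ℤ-combination σ_J of symbols {f₁,…,f_p} (f_i holomorphic units on U_J), read as
the closed holomorphic
p-form Σ n·dlog f₁∧⋯∧dlog f_p, with δσ ≡ 0 modulo the Milnor relations (multilinearity, Steinberg)
on U_{J'} — i.e.
(2πi)^p·m·c ∈ Im(Ȟ^p(X^an, 𝒦^M_{p,an}) → H^p(Ω^p_cl) = F^pH^{2p} → H^{2p}(X,ℂ)). L^p(X) := rational
symbol classes;
Alg^p ⊆ L^p ⊆ Hdg^p. LIFT (SymbolLiftR, 1 ≤ p ≤ dim X; the first filing SymbolLift, stated for every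
p, was
refuted-MISSTATED above the dimension — H^{2p} = 0 there, so the normalisation clause has no
non-zero class — and stays in the
file as the negative record): every rational (p,p) class, p ≤ dim X, is a symbol class (the weight-p
exponential sequence
0 → 𝒩_p → 𝒦^M_{p,an} → Ω^p_cl → 0 kills Hodge classes: ∂_p(Hdg) = 0 in H^{p+1}(X^an,𝒩_p)). GK
(SymbolClassesAlgebraic):
rational symbol classes are algebraic (GAGA for the ONE non-coherent sheaf 𝒦^M_p; for p = 1 this is
Pic X = H¹(X^an,𝒪^*)).
For p = 1 the pair is exactly how Lefschetz (1,1) is proved. The statements are shipped INLINED (no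
new tree
definitions exist yet); the named form (IsSymbolClass etc., definitionally equal,
`Iff.rfl`-certified) is the planner's
Sketch.lean, attached as evidence, and definition requests are filed.
Lean: `SymbolClassesAlgebraic ∧ SymbolLiftR`

## Assembly
Pure logic (sorry-free, `closes` in glue.lean, axioms propext/choice/Quot.sound): for X smooth
projective of dimension n the
anti-vacuity conjunct `Nonempty (HodgeModel n X)` is the support item HodgeModelsExist
(stmt-HodgeConjecture-18143; verbatim the statement of the
summit's shared item stmt-HodgeConjecture-2742, already proved for six routes by
Theorems.holomorphicDefect_hodgeModelsExist_proof;
discharged in tree by `nonempty_hodgeModel_holds`, which the PROVER's Theorems file imports — the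
route file no longer
imports `ComplexConjugationHolds`, cone repair revs 1–3); for p = 0 `hodgeConjectureFor_codim_zero`;
for p = q+1 ≤ n a rational
(p,p) class c is a symbol class by SymbolLiftR and then algebraic by SymbolClassesAlgebraic: Hdg ⊆ L
⊆ Alg; for p > n the class is 0
(`IsOfHodgeType.eq_zero_pp_of_lt`, H^{2p}(X) = 0) and 0 is algebraic (repair rev 4–7 after the
refutation of SymbolLift).

Rationale: WHY THIS LINE. Lefschetz (1,1) = Bloch–Quillen in weight 1 (CH¹ = H¹(𝒦₁)) + GAGA (Pic) + the
exponential sequence; in weight p the first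
survives (Kerz doi:10.1007/s00222-008-0144-8: CH^p = H^p(X_Zar,𝒦^M_p)), the symbol map dlog^∧p :
𝒦^M_{p,an} → Ω^p_cl is onto
with kernel 𝒩_p, and HC(X,p) ⟺ LIFT_p ∧ GK_p with Alg^p ⊆ L^p ⊆ Hdg^p (Esnault
doi:10.1515/crll.1990.411.51 §3 for p = 2 via
Bloch's dilogarithm complex; Esnault–Viehweg zbl:0656.14012; the 2001 internal paper d3a02c7b Thms
A–C, refereed sound
internally, UNPUBLISHED — nothing in `closes` depends on it: Alg ⊆ L re-enters as the support item
AlgebraicClassesAreSymbolClasses, Thm C only as the suggested attack on GK). Imported area: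
algebraic K-theory / regulators
(Milnor K-sheaves, Deligne–Beilinson cohomology, Lichtenbaum cohomology — Rosenschon–Srinivas
doi:10.1017/s1474748014000401:
HC_ℚ ⟺ surjectivity of the étale-motivic cycle map, the arithmetic twin of LIFT∧GK). What it does
that no open route does:
it splits HC at a CANONICAL analytic ℚ-subspace L^p with both halves open and evidenced — 2001
computed (weight-p
Appell–Humbert cocycles, unrefereed Thm 9.6) that on Weil 4- /6-tori the Weil classes ARE symbol
classes, Hdg² = L² even on
Voisin's non-algebraic tori where no coherent sheaf has c₂ ≠ 0 — so LIFT is insensitive to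
projectivity and GK carries it,
the opposite cut from HolomorphicDefect (coniveau one for all Hodge classes, HC-equivalent) and
AffinePartDecay (Oka on X∖H
+ growth at infinity).

RANKED CRUXES. #2 SymbolClassesAlgebraic (crux) — GK_p (Milnor-K GAGA): on a smooth projective
complex variety every RATIONAL symbol class of weight p = q+1 (inlined IsSymbolClass: ∃ normalised
Hodge model, finite open cover, Čech (q+1)-cocycle of good Milnor-symbol chains modulo the Milnor
relations, closed (2q+2)-form transgressing its dlog-forms through the Čech–de Rham zigzag, whose de
Rham class is m•(pull-back of c), m ≠ 0) lies in algebraicClasses X (q+1). 2001 Thm C: equivalent to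
L^p ⊆ N^{p-1}H^{2p} (one coniveau step); first open case (n,p) = (4,2). [difficulty: open-problem]
(why it might fail: H^p(X^an,𝒦^M_p) may be huge (Mumford/Clemens-type infinite-dimensionality) with
rational symbol classes beyond Alg^p, e.g. an exotic symbol cocycle on S×S' (p_g ≥ 1) hitting a
transcendental direction of T(S)⊗T(S') ∩ Hdg — the first test.) [doi:10.1515/crll.1990.411.51,
doi:10.1017/s1474748014000401, doi:10.1023/b:kthe.0000031353.10427.54, zbl:0821.19001,
VoisinHodgeI2002]
#3 SymbolLiftR (crux) — LIFT_p for p = q+1 ≤ n = dim X (weight-p exponential sequence; REPAIRED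
SymbolLift — stmt-HodgeConjecture-17744 was refuted-misstated by
Theorems.MilnorKExponentialSymbolLift_refuted, witness X = ℙ⁰, q = 0, c = 0: above the dimension the
normalisation clause asks for a non-zero rational class in H^{2(q+1)} = 0; C′ = the refuter's
repair, `q + 1 ≤ n` inserted after `∀ (q : ℕ)`; the refuted decl is the route's negative record): on
a smooth projective complex variety of dimension n every rational class of Hodge type (q+1,q+1), q+1
≤ n, is a symbol class of weight q+1 (same inlined IsSymbolClass). Equivalently the connecting map
∂_p : F^pH^{2p} = H^p(X^an,Ω^p_cl) → H^{p+1}(X^an,𝒩_p) of 0 → 𝒩_p → 𝒦^M_{p,an} → Ω^p_cl → 0 kills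
rational (p,p) classes; p = 1 is Lefschetz (1,1); 2001 (unrefereed Thm 9.6) proved it for Weil
classes on Weil 4-tori (all K) and 6-tori (K = ℚ(√-d), d ≤ 7) by explicit Appell–Humbert symbol
cocycles. [difficulty: open-problem] (why it might fail: ∂_p sees arithmetic period data (T𝒦₂ =
Ω¹_{/ℚ}, Green–Griffiths): it is an absolute-Hodge-type obstruction and could be non-zero on a Hodge
class of a non-CM fourfold; within the dimension the normalisation/Tr clause must still be
SATISFIABLE (next cheapest falsifier, refuter R3: ℙ¹, p = 1, c = h) and the
finite-cover/naive-relation typing might miss classes needing sheafification (then refine, or it is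
a real gap).) [doi:10.1515/crll.1990.411.51, zbl:0656.14012, arXiv:1203.2776,
doi:10.1007/s00222-008-0144-8, arXiv:math/0112247]
#9 AlgebraicClassesAreSymbolClasses (support) — Alg^p ⊆ L^p for p = q+1 ≤ n (restated in the same
repair: the first filing had the refuted item's above-the-dimension vacuity, 0 being rational and
algebraic): every rational class in algebraicClasses X (q+1), q+1 ≤ n, is a symbol class of weight
q+1 (2001 Thm A: Bloch–Quillen–Kerz + the dlog/Koszul fundamental class; consistency of the typing —
its refutation means the normalisation/transgression conventions of the inlined IsSymbolClass are
wrong, not that the line is dead). [difficulty: L] [doi:10.1007/s00222-008-0144-8,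
doi:10.1515/crll.1990.411.51, internal-2001-analytic-milnor-k-cohomology-ThmA]
#9 SymbolClassesHodgeType (support) — L^p ⊆ Hdg^p: a rational symbol class of weight q+1 is of Hodge
type (q+1,q+1) (transgressions of Čech cocycles of holomorphic p-forms lie in F^pH^{2p}; rational ∩
F^p = Hodge). Sanity of the typing and the HC ⇒ GK direction. [difficulty: M] [VoisinHodgeI2002,
zbl:0656.14012]

TWO-LAYER PLAN. Foreseen glued splits (birth skeletons bc/*_birth.lean, to be published as
Lines/birth.lean): SymbolClassesAlgebraic ⇐
SymbolHodgeType → SymbolConiveau (rational symbol classes of weight q+1 lie in supportedClasses X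
(2q+2) q = N^{p-1}; the
GAGA content, 2001 Thm C) → SupportedHodgeAlgebraic (Voisin 2013 Lemma 2.1 = tree
`supportedHodgeClass_algebraic_of_facts`);
SymbolLiftR ⇐ FormLift (every (p,p) class, p ≤ dim X, is the transgression of form-level symbol data
on a Stein good cover: Čech–Dolbeault +
dη = dlog(exp η)) → SymbolCorrection (for rational (p,p) classes the form-level data corrects to a
Milnor cocycle: ∂_p = 0).
Later, per 2001 ONWARD: LIFT on abelian varieties ⇐ weight-p Appell–Humbert (level one ⟺ Hodge on
the pattern family;
constant levels unobstructed) → André (CM Hodge classes from Weil classes); GK_2 ⇐ rational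
Bloch–Lichtenbaum surjectivity
CH²_ℚ → 𝐇⁴(X^an,B)⊗ℚ ⇐ comparison with H⁴_L(X,ℤ(2)).

KILL CRITERIA. A rational symbol class that is provably NOT algebraic (¬SymbolClassesAlgebraic, e.g.
on S×S' or a CY/HK fourfold) closes the
route `refuted:SymbolClassesAlgebraic` and — since Hdg ⊆ L is then the only way out — hands the
witness to the negative side
(it is a Hodge class iff SymbolClassesHodgeType, so it would REFUTE HC if also (p,p)). A rational
(p,p) class, p ≤ dim X, with ∂_p ≠ 0
(¬SymbolLiftR) kills LIFT (the vacuity refutation of the first filing SymbolLift above the dimension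
did not: misstated, repaired rev 4–7): pivot to the restricted thesis "LIFT for CM-abelian /
motivated classes" as a sector or retire. A
refutation of AlgebraicClassesAreSymbolClasses or SymbolClassesHodgeType kills the TYPING
(normalisation clause / zigzag
conventions): repair by restating IsSymbolClass (definition items), not by closing. HC proved
elsewhere moots the route;
GK proved with LIFT refuted (or vice versa) converts it into a reformulation record.

NOT DECOMPOSED YET. No items for: the Leray–coniveau criterion (GK ⟺ L^p ⊆ N^{p-1}, 2001 Thm C),
Stein acyclicity H^b(ℂ^n,𝒦^M_{p,an}) = 0
(2001 Q1), the projective-bundle formula for analytic Milnor K-cohomology (Q2), unique divisibility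
of 𝒦^M_{p,an} for p ≥ 2
(Lemma 7.1), the torus/abelian special case of LIFT (weight-p Appell–Humbert, Thm 9.6) and the p = 2
Bloch-complex
reformulations (walls W_2a/W_3a) — all layer-2 children or stubs once a crux is staffed; the named
definitions
(IsHolUnitOn, milnorRel, dlogWedge, symbolForm, IsTransgression, IsSymbolNormalized, IsSymbolClass)
are filed as
definition requests so the inlined statements can be restated by name.

CHEAPEST FALSIFIER. Typing: prove `h^{q+1}` (power of the hyperplane class) is a symbol class — it
is the cup power of the O(1)-cocycle, i.e.
the normalisation clause itself; if this FAILS to be provable the inlined IsSymbolClass is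
mis-normalised (one afternoon of
Lean against CechDeRham/HolomorphicLineBundle). Mathematics: re-run the 2001 exact
Čech–Appell–Humbert solver (kpah.py
method: Λ₂-cocycles of symbols in e^{2πiz_k}, e^{2πiτ_ka}) on a CM abelian fourfold that is NOT of
Weil type and on E×E×E×E
(HC known): LIFT_2 must hold there; a failure refutes SymbolLiftR at once (kit job, < 1 h). Before
that (refuter R3's next cheapest falsifier): SATISFIABILITY of the normalisation/Tr clause on (ℙ¹, p
= 1, c = h) — the typing test that the ℙ⁰ vacuity witness points at inside the dimension. I could
not run it this cycle
(no kit in planner seat); the 2001 runs (8 families) all gave image = Hdg² ∩ block.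

NUMBERS. Known: LIFT_1 ∧ GK_1 = Lefschetz (1,1) + GAGA (all X); HC(X,p) hence LIFT_p ∧ GK_p for dim
X ≤ 3, p = n-1, n; 2001: LIFT for
Weil classes on Weil tori of dim 4 (all imaginary quadratic K) and 6 (ℚ(√-d), d ∈ {1,2,3,7});
integral GK_2 FALSE on Kollár
threefolds (Thm 7.4) — hence `m ≠ 0`; 𝒦^M_{p,an} uniquely divisible for p ≥ 2 (Lemma 7.1). First
open cases: GK_2 and LIFT_2
on fourfolds with CH₀ large (S×S', HK, CY, special complete intersections). Items at open: 5 (2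
cruxes, 2 supports, assembly); after the cone repair (revs 1–3) and the refutation repair (revs
4–7): 2 live cruxes (SymbolClassesAlgebraic r2, SymbolLiftR r3), 3 supports
(AlgebraicClassesAreSymbolClasses restated, SymbolClassesHodgeType, HodgeModelsExist), Assembly, and
the refuted SymbolLift as negative record.

DEFINITION REQUESTS. To be filed right after open (`ledger workitem add --kind definition`):
Literature/Geometry/Kaehler — `MilnorSymbolCocycle`
(IsHolUnitOn, milnorRel = naive K^M_p relations on good tuples, dlog, dlogWedge via Fin.hIterate,
symbolForm, Čech symbol
cocycles on an open cover) and `CechDeRhamTransgression` (IsTransgression: the Bott–Tu zigzag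
predicate through CechForms);
Summits/HodgeConjecture/HodgeConjecture/Theorems — `SymbolClasses` (IsSymbolNormalized,
IsSymbolClass over HodgeModel). Text =
the planner's Sketch.lean (rc 0), attached as evidence; once landed, restate the four items by name
(definitionally equal).

Novelty: Searches (2026-08-17): `lit search --source zbmath` for "dilogarithmic cycle class map Krishna" (1:
doi:10.1023/b:kthe.0000031353.10427.54), "etale motivic cohomology algebraic cycles Rosenschon
Srinivas" (doi:10.1017/s1474748014000401), "holomorphic gerbes Beilinson regulator"
(zbl:0821.19001), "Gersten conjecture Milnor K-theory Kerz" (doi:10.1007/s00222-008-0144-8),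
"Esnault note on the cycle map" (doi:10.1515/crll.1990.411.51), "Milnor K-theory sheaf complex
analytic" (0 relevant); `lit galaxy search "Deligne-Beilinson cohomology" --star all` (8 pdf hits,
none on Hodge classes as symbol classes); local `lit search --hybrid` unavailable this session
(searchd connection reset, retried ×3); tree: `lean search` IsSymbolClass/SymbolLift/Milnor (no
decl), 38 open HodgeConjecture routes read (none K-theoretic), idea cards milnor-k-gerbe-exponential
(variant, open, unrouted), hodge-pfister-generic-symbol (mod-2 generic symbols, negative side),
continuous-k-theory-algebraization (p-adic K^cont).
Nearest prior art found: the 2001 internal route hodge/analytic-milnor-k-cohomology (paper d3a02c7b: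
Thm B HC ⟺ LIFT∧GK, Thm C, Lemma 7.1, Thm 7.4, §9 Appell–Humbert; walls W_2a/W_3a) and its printed
roots Esnault 1990 (doi:10.1515/crll.1990.411.51, the analytic sheaf K₂ and Bloch–Lichtenbaum's
question 3.1), Krishna 2004 (doi:10.1023/b:kthe.0000031353.10427.54, injectivity side of the
dilogarithmic cycle map), Rosenschon–Srinivas 2016 (HC ⟺ L-cycle-map surjectivity); in-programme:
card mi  [refs: 10.1023/b:kthe.0000031353.10427.54, 10.1017/s1474748014000401, 10.1007/s00222-008-0144-8, 10.1515/crll.1990.411.51, doi:10.1023/b, doi:10.1017/s1474748014000401, doi:10.1007/s00222-008-0144-8, doi:10.1515/crll.1990.411.51]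

Barriers (technique_class: analytic-k-theory, milnor-k-sheaf, exponential-sequence, gaga): - technique_class: analytic-k-theory, milnor-k-sheaf, exponential-sequence, gaga
- Literature.Barriers.HodgeConjecture.Voisin2002_weilTorus_hodgeClassWithoutSubvarieties: evaded —
symbol cocycles are not coherent sheaves/analytic cycles; on Voisin's very Weil tori the 2001
computation gives Hdg² = L² (LIFT holds where every coherent sheaf has c₂ = 0), and projectivity is
used only in GK, exactly where Charles–Schnell say it must enter.
- Literature.Barriers.HodgeConjecture.Zucker1977_kaehlerTorus_noAnalyticCycles: same answer (LIFT is
a Kähler statement, GK is not claimed off the projective world).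
- Literature.Barriers.HodgeConjecture.AtiyahHirzebruch1962_torsionClass_notAlgebraic: rational
statements only (`∃ m ≠ 0`); 𝒦^M_(p,an) is a ℚ-sheaf for p ≥ 2 so torsion is invisible by
construction.
- Literature.Barriers.HodgeConjecture.Kollar1992_nonTorsionClass_notAlgebraic: integral GK_2 is
FALSE on Kollár threefolds (2001 Thm 7.4) — the cruxes are the rational forms, which survive.
-
Literature.Barriers.HodgeConjecture.BarbieriVialeSrinivas1994_singularLefschetzOneOne_counterexample:
smooth projective X only; the weight-1 case of the sequence is the classical exponential sequence
whose singular failure is that barrier.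
- Literature.Barriers.HodgeConjecture.Clemens1983_griffithsGroup_infiniteRank: no finiteness of
H^p(𝒦^M_p) is claimed — only its image in the finite-dimensional F^pH^(2p) is used.
- Literature.Barriers.HodgeConjecture.Serre1964_conjugateVarieties_notHomeomorphic:

History (route lifecycle, newest last):
- 2026-08-17T02:22:51Z · rev 2: restated Assembly (stmt-HodgeConjecture-17747) — cone repair rev 2: restate Assembly to carry HodgeModelsExist like `closes` (rev 1 added the item and dropped import ComplexConjugationHolds); the old form GK → (planner-rrepair-HodgeConjecture-MilnorKExponen-fbe2b952-0)
- 2026-08-17T02:39:33Z · BROKEN — SymbolLift (stmt-HodgeConjecture-17744, crux) refuted by Summit.HodgeConjecture.HodgeConjecture.Theorems.MilnorKExponentialSymbolLift_refuted @ 45f07759507b (refuter-rreview-0817T02-2-0)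
- 2026-08-17T02:56:12Z · rev 5: restated AlgebraicClassesAreSymbolClasses (stmt-HodgeConjecture-17745) — repair (2/4): restate the support AlgebraicClassesAreSymbolClasses (stmt-17745) with q+1 ≤ n — it carried the same above-the-dimension vacuity as the refuted Sy (planner-rfix-HodgeConjecture-MilnorKExponent-fbe2b952-0)
- 2026-08-17T02:57:22Z · rev 6: restated Assembly (stmt-HodgeConjecture-18178) — repair (3/4): Assembly and the deciding theorem now run through SymbolLiftR (repaired LIFT, q+1 ≤ n) instead of the refuted SymbolLift; closes discharges p > di (planner-rfix-HodgeConjecture-MilnorKExponent-fbe2b952-0)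
- 2026-08-17T02:58:25Z · rev 7: dropped SymbolLift — repair (4/4): drop the refuted-misstated SymbolLift (stmt-17744, ¬ by Theorems.MilnorKExponentialSymbolLift_refuted @45f07759507b, ℙ⁰/q=0/c=0 vacuity above the (planner-rfix-HodgeConjecture-MilnorKExponent-fbe2b952-0)
- 2026-08-17T02:58:25Z · REPAIRED (drop SymbolLift) — back to open: repair (4/4): drop the refuted-misstated SymbolLift (stmt-17744, ¬ by Theorems.MilnorKExponentialSymbolLift_refuted @45f07759507b, ℙ⁰/q=0/c=0 vacuity above the (planner-rfix-HodgeConjecture-MilnorKExponent-fbe2b952-0)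
- 2026-08-26T14:58:55Z · DORMANT — reconciler: no traction for 6.7 d (last activity item-proof-filed at 2026-08-19T22:25:48Z); parked, not closed — `ledger route dormant route-HodgeConjecture-Mil (operator:999:3710898)

sub-problem: HodgeConjecture · status: dormant · opened planner-plan-lens3-HodgeConjecture-resurrect-0 2026-08-17T02:07:43Z · rev 7 · ledger route-HodgeConjecture-MilnorKExponential
GENERATED by the gate from the ledger (D-0016/17). Provers cite these decls: `theorem foo : Summit.HodgeConjecture.HodgeConjecture.Theses.MilnorKExponential.<Decl> := …` in Summits/HodgeConjecture/HodgeConjecture/Theorems/<Name>.lean.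
-/

namespace Summit.HodgeConjecture.HodgeConjecture.Theses.MilnorKExponential

open scoped BigOperators Topology Manifold Classical MeasureTheory ProbabilityTheory Matrix InnerProductSpace ComplexConjugate ContinuousMap
open Filter Set Function TopologicalSpace MeasureTheory

attribute [summit_statement] _root_.HodgeConjecture

/-- item stmt-HodgeConjecture-17743 · crux · rank 2 · open · by planner
why it might fail: H^p(X^an,𝒦^M_p) may be huge (Mumford/Clemens-type infinite-dimensionality) with rational symbol classes beyond Alg^p, e.g. an exotic symbol cocycle on S×S' (p_g ≥ 1) hitting a transcendental direction of T(S)⊗T(S') ∩ Hdg — the first test.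
sources: doi:10.1515/crll.1990.411.51, doi:10.1017/s1474748014000401, doi:10.1023/b:kthe.0000031353.10427.54, zbl:0821.19001, VoisinHodgeI2002
[crux] GK_p (Milnor-K GAGA): on a smooth projective complex variety every RATIONAL symbol class of
weight p = q+1 (inlined IsSymbolClass: ∃ normalised Hodge model, finite open cover, Čech
(q+1)-cocycle of good Milnor-symbol chains modulo the Milnor relations, closed (2q+2)-form
transgressing its dlog-forms through the Čech–de Rham zigzag, whose de Rham class is m•(pull-back of
c), m ≠ 0) lies in algebraicClasses X (q+1). 2001 Thm C: equivalent to L^p ⊆ N^{p-1}H^{2p} (one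
coniveau step); first open case (n,p) = (4,2). [difficulty: open-problem] -/
@[route_item "route-HodgeConjecture-MilnorKExponential", crux]
def SymbolClassesAlgebraic : Prop :=
  ∀ ⦃n : ℕ⦄ ⦃X : Literature.AlgebraicGeometry.Motives.SchemeOver ℂ⦄, Literature.AlgebraicGeometry.Motives.IsSmoothProjective n X → ∀ (q : ℕ) (c : Literature.AlgebraicGeometry.HodgeTheory.complexBetti X (2 * (q + 1))), Literature.AlgebraicGeometry.HodgeTheory.IsRationalClass c → (∃ A : Literature.AlgebraicGeometry.HodgeTheory.HodgeModel n X, let F : ℕ → Type := fun k ↦ Literature.Geometry.Kaehler.MForm 𝓘(ℝ, A.model) A.carrier ℂ k; let CF := Literature.NumberTheory.Transcendental.cclosedSmoothForms A.model A.carrier (2 * q + 1 + 1); let MK := Literature.NumberTheory.Transcendental.complexDeRhamCohomology.mk A.model A.carrier (2 * q + 1 + 1); let DR := A.deRham A.carrier (2 * q + 1 + 1); let T : Type := Fin (q + 1) → (A.carrier → ℂ); let IsU : Set A.carrier → (A.carrier → ℂ) → Prop := fun W f ↦ MDifferentiableOn 𝓘(ℂ, A.model) 𝓘(ℂ, ℂ)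 f W ∧ ∀ x ∈ W, f x ≠ 0; let Good : Set A.carrier → T → Prop := fun W t ↦ ∀ i, IsU W (t i); let Rel : Set A.carrier → AddSubgroup (T →₀ ℤ) := fun W ↦ AddSubgroup.closure ({s : T →₀ ℤ | ∃ t t' : T, Good W t ∧ Good W t' ∧ (∀ i, ∀ x ∈ W, t i x = t' i x) ∧ s = Finsupp.single t 1 - Finsupp.single t' 1} ∪ {s : T →₀ ℤ | ∃ (t : T) (i : Fin (q + 1)) (g : A.carrier → ℂ), Good W t ∧ IsU W g ∧ s = Finsupp.single (Function.update t i (t i * g)) 1 - Finsupp.single t 1 - Finsupp.single (Function.update t i g) 1} ∪ {s : T →₀ ℤ | ∃ (t : T) (i j : Fin (q + 1)), Good W t ∧ i ≠ j ∧ (∀ x ∈ W, t i x + t j x = 1) ∧ s = Finsupp.single t 1}); let DW : T → F (q + 1) := fun t ↦ Fin.hIterate (fun k : ℕ ↦ F k) (Literature.Geometry.Kaehler.MForm.ofFun 𝓘(ℝ, A.model) (fun _ : A.carrier ↦ (1 : ℂ))) (fun (i : Fin (q + 1)) (acc : F (i : ℕ)) ↦ Literature.Geometry.Kaehler.MForm.wedge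 acc (fun x : A.carrier ↦ (t i x)⁻¹ • Literature.Geometry.Kaehler.mextDeriv (Literature.Geometry.Kaehler.MForm.ofFun 𝓘(ℝ, A.model) (t i)) x)); let SF : (T →₀ ℤ) → F (q + 1) := fun σ ↦ Finsupp.sum σ fun (t : T) (z : ℤ) ↦ z • DW t; let Tr : (ι : Type) → (U : ι → Set A.carrier) → (∀ i, IsOpen (U i)) → ((Fin (q + 2) → ι) → F (q + 1)) → F (2 * q + 1 + 1) → Prop := fun ι U hU w θ ↦ ∃ Z : (a b : ℕ) → Literature.Geometry.Kaehler.CechForms 𝓘(ℝ, A.model) ℂ U a b, (∀ (J : Fin (q + 2) → ι), ∀ x ∈ Literature.Geometry.Kaehler.cechSet U J, ((Literature.Geometry.Kaehler.cechδ 𝓘(ℝ, A.model) ℂ hU q (q + 1) (Z q (q + 1)) J : F (q + 1)) x = w J x)) ∧ (∀ a b : ℕ, a + 1 + b = 2 * q + 1 → a < q → Literature.Geometry.Kaehler.cechd 𝓘(ℝ, A.model) ℂ hU (a + 1) b (Z (a + 1) b) = Literature.Geometry.Kaehler.cechδ 𝓘(ℝ, A.model) ℂ hU a (b + 1) (Z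 a (b + 1))) ∧ (∀ (J : Fin 1 → ι), ∀ x ∈ Literature.Geometry.Kaehler.cechSet U J, ((Literature.Geometry.Kaehler.cechd 𝓘(ℝ, A.model) ℂ hU 0 (2 * q + 1) (Z 0 (2 * q + 1)) J : F (2 * q + 1 + 1)) x = θ x)); (∃ (ι : Type) (_ : Fintype ι) (L : Literature.Geometry.Kaehler.HolomorphicLineBundle ι A.model A.carrier) (θ₀ : CF) (c₀ : Literature.AlgebraicGeometry.HodgeTheory.complexBetti X (2 * q + 1 + 1)), Tr ι L.baseSet L.isOpen_baseSet (fun J ↦ SF (Finsupp.single (fun i : Fin (q + 1) ↦ L.coordChange (J (Fin.castSucc i)) (J i.succ)) 1)) θ₀ ∧ Literature.AlgebraicGeometry.HodgeTheory.IsRationalClass c₀ ∧ c₀ ≠ 0 ∧ DR (MK θ₀) = A.pullback (2 * q + 1 + 1) c₀) ∧ (∃ (ι : Type) (_ : Fintype ι) (U : ι → Set A.carrier) (hU : ∀ i, IsOpen (U i)) (_ : ∀ x, ∃ i, x ∈ U i) (σ : (Fin (q + 2) → ι) → (T →₀ ℤ)) (_ : ∀ J, ∀ t ∈ (σ J).support,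 Good (Literature.Geometry.Kaehler.cechSet U J) t) (_ : ∀ J' : Fin (q + 3) → ι, (∑ j : Fin (q + 3), ((-1 : ℤ) ^ (j : ℕ)) • σ (J' ∘ Fin.succAbove j)) ∈ Rel (Literature.Geometry.Kaehler.cechSet U J')) (θ : CF) (m : ℤ), m ≠ 0 ∧ Tr ι U hU (fun J ↦ SF (σ J)) θ ∧ DR (MK θ) = (m : ℂ) • A.pullback (2 * q + 1 + 1) c)) → c ∈ Literature.AlgebraicGeometry.HodgeTheory.algebraicClasses X (q + 1)

/-- item stmt-HodgeConjecture-18702 · crux · rank 3 · open · by planner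
why it might fail: ∂_p is an absolute-Hodge-type obstruction (T𝒦₂ = Ω¹_{/ℚ}, Green–Griffiths) and may be non-zero on a Hodge class of a non-CM fourfold; and within the dimension the normalisation/Tr clause must be satisfiable (next falsifier: ℙ¹, p = 1, c = h) or the typing is wrong.
sources: doi:10.1515/crll.1990.411.51, zbl:0656.14012, arXiv:1203.2776, doi:10.1007/s00222-008-0144-8, arXiv:math/0112247, Summit.HodgeConjecture.HodgeConjecture.Theorems.MilnorKExponentialSymbolLift_refuted
[crux] REPAIRED SymbolLift (stmt-HodgeConjecture-17744, refuted-misstated by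
Summit.HodgeConjecture.HodgeConjecture.Theorems.MilnorKExponentialSymbolLift_refuted @45f07759507b:
above the dimension the inlined normalisation clause asks for a NON-ZERO rational class in
H^{2(q+1)}(X) = 0; witness X = ℙ⁰, q = 0, c = 0). C′ = the refuter's repair: the same signature with
`q + 1 ≤ n` inserted after `∀ (q : ℕ)`. LIFT_p for 1 ≤ p = q+1 ≤ n = dim X (weight-p exponential
sequence): on a smooth projective complex variety of dimension n every rational class of Hodge type
(q+1,q+1), q+1 ≤ n, is a symbol class of weight q+1 (same inlined IsSymbolClass: ∃ normalised Hodge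
model, finite open cover, Čech (q+1)-cocycle of good Milnor-symbol chains modulo the Milnor
relations, closed (2q+2)-form transgressing its dlog-forms through the Čech–de Rham zigzag, de Rham
class = m•(pull-back of c), m ≠ 0). Degrees 2p > 2 dim X carry no content (H^{2p} = 0; `closes`
discharges them by IsOfHodgeType.eq_zero_pp_of_lt + zero_mem). Equivalently ∂_p : F^pH^{2p} →
H^{p+1}(X^an,𝒩_p) kills rational (p,p) classes for p ≤ n; p = 1 is Lefschetz (1,1); 2001 (unrefereed
Thm 9.6) for Weil classes on Weil 4- /6-tori. [deps: -/
@[route_item "route-HodgeConjecture-MilnorKExponential", crux]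
def SymbolLiftR : Prop :=
  ∀ ⦃n : ℕ⦄ ⦃X : Literature.AlgebraicGeometry.Motives.SchemeOver ℂ⦄, Literature.AlgebraicGeometry.Motives.IsSmoothProjective n X → ∀ (q : ℕ), q + 1 ≤ n → ∀ (c : Literature.AlgebraicGeometry.HodgeTheory.complexBetti X (2 * (q + 1))), Literature.AlgebraicGeometry.HodgeTheory.IsRationalClass c → Literature.AlgebraicGeometry.HodgeTheory.IsOfHodgeType n X (2 * (q + 1)) (q + 1) (q + 1) c → (∃ A : Literature.AlgebraicGeometry.HodgeTheory.HodgeModel n X, let F : ℕ → Type := fun k ↦ Literature.Geometry.Kaehler.MForm 𝓘(ℝ, A.model) A.carrier ℂ k; let CF := Literature.NumberTheory.Transcendental.cclosedSmoothForms A.model A.carrier (2 * q + 1 + 1); let MK := Literature.NumberTheory.Transcendental.complexDeRhamCohomology.mk A.model A.carrier (2 * q + 1 + 1); let DR := A.deRham A.carrier (2 * q + 1 + 1); let T : Type := Fin (q + 1) → (A.carrier → ℂ); let IsU : Set A.carrier → (A.carrier → ℂ) → Prop := fun W f ↦ MDifferentiableOn 𝓘(ℂ, A.model) 𝓘(ℂ,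 ℂ) f W ∧ ∀ x ∈ W, f x ≠ 0; let Good : Set A.carrier → T → Prop := fun W t ↦ ∀ i, IsU W (t i); let Rel : Set A.carrier → AddSubgroup (T →₀ ℤ) := fun W ↦ AddSubgroup.closure ({s : T →₀ ℤ | ∃ t t' : T, Good W t ∧ Good W t' ∧ (∀ i, ∀ x ∈ W, t i x = t' i x) ∧ s = Finsupp.single t 1 - Finsupp.single t' 1} ∪ {s : T →₀ ℤ | ∃ (t : T) (i : Fin (q + 1)) (g : A.carrier → ℂ), Good W t ∧ IsU W g ∧ s = Finsupp.single (Function.update t i (t i * g)) 1 - Finsupp.single t 1 - Finsupp.single (Function.update t i g) 1} ∪ {s : T →₀ ℤ | ∃ (t : T) (i j : Fin (q + 1)), Good W t ∧ i ≠ j ∧ (∀ x ∈ W, t i x + t j x = 1) ∧ s = Finsupp.single t 1}); let DW : T → F (q + 1) := fun t ↦ Fin.hIterate (fun k : ℕ ↦ F k) (Literature.Geometry.Kaehler.MForm.ofFun 𝓘(ℝ, A.model) (fun _ : A.carrier ↦ (1 : ℂ))) (fun (i : Fin (q + 1)) (acc : F (i : ℕ)) ↦ Literature.Geometry.Kaehler.MForm.wedge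 acc (fun x : A.carrier ↦ (t i x)⁻¹ • Literature.Geometry.Kaehler.mextDeriv (Literature.Geometry.Kaehler.MForm.ofFun 𝓘(ℝ, A.model) (t i)) x)); let SF : (T →₀ ℤ) → F (q + 1) := fun σ ↦ Finsupp.sum σ fun (t : T) (z : ℤ) ↦ z • DW t; let Tr : (ι : Type) → (U : ι → Set A.carrier) → (∀ i, IsOpen (U i)) → ((Fin (q + 2) → ι) → F (q + 1)) → F (2 * q + 1 + 1) → Prop := fun ι U hU w θ ↦ ∃ Z : (a b : ℕ) → Literature.Geometry.Kaehler.CechForms 𝓘(ℝ, A.model) ℂ U a b, (∀ (J : Fin (q + 2) → ι), ∀ x ∈ Literature.Geometry.Kaehler.cechSet U J, ((Literature.Geometry.Kaehler.cechδ 𝓘(ℝ, A.model) ℂ hU q (q + 1) (Z q (q + 1)) J : F (q + 1)) x = w J x)) ∧ (∀ a b : ℕ, a + 1 + b = 2 * q + 1 → a < q → Literature.Geometry.Kaehler.cechd 𝓘(ℝ, A.model) ℂ hU (a + 1) b (Z (a + 1) b) = Literature.Geometry.Kaehler.cechδ 𝓘(ℝ, A.model) ℂ hU a (b + 1) (Z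 a (b + 1))) ∧ (∀ (J : Fin 1 → ι), ∀ x ∈ Literature.Geometry.Kaehler.cechSet U J, ((Literature.Geometry.Kaehler.cechd 𝓘(ℝ, A.model) ℂ hU 0 (2 * q + 1) (Z 0 (2 * q + 1)) J : F (2 * q + 1 + 1)) x = θ x)); (∃ (ι : Type) (_ : Fintype ι) (L : Literature.Geometry.Kaehler.HolomorphicLineBundle ι A.model A.carrier) (θ₀ : CF) (c₀ : Literature.AlgebraicGeometry.HodgeTheory.complexBetti X (2 * q + 1 + 1)), Tr ι L.baseSet L.isOpen_baseSet (fun J ↦ SF (Finsupp.single (fun i : Fin (q + 1) ↦ L.coordChange (J (Fin.castSucc i)) (J i.succ)) 1)) θ₀ ∧ Literature.AlgebraicGeometry.HodgeTheory.IsRationalClass c₀ ∧ c₀ ≠ 0 ∧ DR (MK θ₀) = A.pullback (2 * q + 1 + 1) c₀) ∧ (∃ (ι : Type) (_ : Fintype ι) (U : ι → Set A.carrier) (hU : ∀ i, IsOpen (U i)) (_ : ∀ x, ∃ i, x ∈ U i) (σ : (Fin (q + 2) → ι) → (T →₀ ℤ)) (_ : ∀ J, ∀ t ∈ (σ J).support,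 Good (Literature.Geometry.Kaehler.cechSet U J) t) (_ : ∀ J' : Fin (q + 3) → ι, (∑ j : Fin (q + 3), ((-1 : ℤ) ^ (j : ℕ)) • σ (J' ∘ Fin.succAbove j)) ∈ Rel (Literature.Geometry.Kaehler.cechSet U J')) (θ : CF) (m : ℤ), m ≠ 0 ∧ Tr ι U hU (fun J ↦ SF (σ J)) θ ∧ DR (MK θ) = (m : ℂ) • A.pullback (2 * q + 1 + 1) c))

/-- item stmt-HodgeConjecture-17746 · support · rank 9 · closed · proved by Summit.HodgeConjecture.HodgeConjecture.Theorems.symbolClassesHodgeType_proof @ 95fa61c19ef9 (prover) · by planner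
sources: VoisinHodgeI2002, zbl:0656.14012
[support] L^p ⊆ Hdg^p: a rational symbol class of weight q+1 is of Hodge type (q+1,q+1)
(transgressions of Čech cocycles of holomorphic p-forms lie in F^pH^{2p}; rational ∩ F^p = Hodge).
Sanity of the typing and the HC ⇒ GK direction. [difficulty: M] -/
@[route_item "route-HodgeConjecture-MilnorKExponential"]
def SymbolClassesHodgeType : Prop :=
  ∀ ⦃n : ℕ⦄ ⦃X : Literature.AlgebraicGeometry.Motives.SchemeOver ℂ⦄, Literature.AlgebraicGeometry.Motives.IsSmoothProjective n X → ∀ (q : ℕ) (c : Literature.AlgebraicGeometry.HodgeTheory.complexBetti X (2 * (q + 1))), Literature.AlgebraicGeometry.HodgeTheory.IsRationalClass c → (∃ A : Literature.AlgebraicGeometry.HodgeTheory.HodgeModel n X, let F : ℕ → Type := fun k ↦ Literature.Geometry.Kaehler.MForm 𝓘(ℝ, A.model) A.carrier ℂ k; let CF := Literature.NumberTheory.Transcendental.cclosedSmoothForms A.model A.carrier (2 * q + 1 + 1); let MK := Literature.NumberTheory.Transcendental.complexDeRhamCohomology.mk A.model A.carrier (2 * q + 1 + 1); let DR := A.deRham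 A.carrier (2 * q + 1 + 1); let T : Type := Fin (q + 1) → (A.carrier → ℂ); let IsU : Set A.carrier → (A.carrier → ℂ) → Prop := fun W f ↦ MDifferentiableOn 𝓘(ℂ, A.model) 𝓘(ℂ, ℂ) f W ∧ ∀ x ∈ W, f x ≠ 0; let Good : Set A.carrier → T → Prop := fun W t ↦ ∀ i, IsU W (t i); let Rel : Set A.carrier → AddSubgroup (T →₀ ℤ) := fun W ↦ AddSubgroup.closure ({s : T →₀ ℤ | ∃ t t' : T, Good W t ∧ Good W t' ∧ (∀ i, ∀ x ∈ W, t i x = t' i x) ∧ s = Finsupp.single t 1 - Finsupp.single t' 1} ∪ {s : T →₀ ℤ | ∃ (t : T) (i : Fin (q + 1)) (g : A.carrier → ℂ), Good W t ∧ IsU W g ∧ s = Finsupp.single (Function.update t i (t i * g)) 1 - Finsupp.single t 1 - Finsupp.single (Function.update t i g) 1} ∪ {s : T →₀ ℤ | ∃ (t : T) (i j : Fin (q + 1)), Good W t ∧ i ≠ j ∧ (∀ x ∈ W, t i x + t j x = 1) ∧ s = Finsupp.single t 1}); let DW : T → F (q + 1) := fun t ↦ Fin.hIterate (fun k : ℕ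 ↦ F k) (Literature.Geometry.Kaehler.MForm.ofFun 𝓘(ℝ, A.model) (fun _ : A.carrier ↦ (1 : ℂ))) (fun (i : Fin (q + 1)) (acc : F (i : ℕ)) ↦ Literature.Geometry.Kaehler.MForm.wedge acc (fun x : A.carrier ↦ (t i x)⁻¹ • Literature.Geometry.Kaehler.mextDeriv (Literature.Geometry.Kaehler.MForm.ofFun 𝓘(ℝ, A.model) (t i)) x)); let SF : (T →₀ ℤ) → F (q + 1) := fun σ ↦ Finsupp.sum σ fun (t : T) (z : ℤ) ↦ z • DW t; let Tr : (ι : Type) → (U : ι → Set A.carrier) → (∀ i, IsOpen (U i)) → ((Fin (q + 2) → ι) → F (q + 1)) → F (2 * q + 1 + 1) → Prop := fun ι U hU w θ ↦ ∃ Z : (a b : ℕ) → Literature.Geometry.Kaehler.CechForms 𝓘(ℝ, A.model) ℂ U a b, (∀ (J : Fin (q + 2) → ι), ∀ x ∈ Literature.Geometry.Kaehler.cechSet U J, ((Literature.Geometry.Kaehler.cechδ 𝓘(ℝ, A.model) ℂ hU q (q + 1) (Z q (q + 1)) J : F (q + 1)) x = w J x)) ∧ (∀ a b : ℕ, a + 1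 + b = 2 * q + 1 → a < q → Literature.Geometry.Kaehler.cechd 𝓘(ℝ, A.model) ℂ hU (a + 1) b (Z (a + 1) b) = Literature.Geometry.Kaehler.cechδ 𝓘(ℝ, A.model) ℂ hU a (b + 1) (Z a (b + 1))) ∧ (∀ (J : Fin 1 → ι), ∀ x ∈ Literature.Geometry.Kaehler.cechSet U J, ((Literature.Geometry.Kaehler.cechd 𝓘(ℝ, A.model) ℂ hU 0 (2 * q + 1) (Z 0 (2 * q + 1)) J : F (2 * q + 1 + 1)) x = θ x)); (∃ (ι : Type) (_ : Fintype ι) (L : Literature.Geometry.Kaehler.HolomorphicLineBundle ι A.model A.carrier) (θ₀ : CF) (c₀ : Literature.AlgebraicGeometry.HodgeTheory.complexBetti X (2 * q + 1 + 1)), Tr ι L.baseSet L.isOpen_baseSet (fun J ↦ SF (Finsupp.single (fun i : Fin (q + 1) ↦ L.coordChange (J (Fin.castSucc i)) (J i.succ)) 1)) θ₀ ∧ Literature.AlgebraicGeometry.HodgeTheory.IsRationalClass c₀ ∧ c₀ ≠ 0 ∧ DR (MK θ₀) = A.pullback (2 * q + 1 + 1) c₀) ∧ (∃ (ι : Type)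 (_ : Fintype ι) (U : ι → Set A.carrier) (hU : ∀ i, IsOpen (U i)) (_ : ∀ x, ∃ i, x ∈ U i) (σ : (Fin (q + 2) → ι) → (T →₀ ℤ)) (_ : ∀ J, ∀ t ∈ (σ J).support, Good (Literature.Geometry.Kaehler.cechSet U J) t) (_ : ∀ J' : Fin (q + 3) → ι, (∑ j : Fin (q + 3), ((-1 : ℤ) ^ (j : ℕ)) • σ (J' ∘ Fin.succAbove j)) ∈ Rel (Literature.Geometry.Kaehler.cechSet U J')) (θ : CF) (m : ℤ), m ≠ 0 ∧ Tr ι U hU (fun J ↦ SF (σ J)) θ ∧ DR (MK θ) = (m : ℂ) • A.pullback (2 * q + 1 + 1) c)) → Literature.AlgebraicGeometry.HodgeTheory.IsOfHodgeType n X (2 * (q + 1)) (q + 1) (q + 1) c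

-- `SymbolClassesHodgeType` holds: proved by `Summit.HodgeConjecture.HodgeConjecture.Theorems.symbolClassesHodgeType_proof` @ 95fa61c19ef9 (its module imports this route file, so no `_holds` link can be stated here).

/-- item stmt-HodgeConjecture-18143 · support · rank 9 · closed · proved by Summit.HodgeConjecture.HodgeConjecture.Theorems.genericDivisibility_hodgeModelsExist_proof @ 8e7689d4c59e (prover) · by planner
[support] every smooth projective complex variety of dimension n has a Hodge model — the
anti-vacuity conjunct `Nonempty (HodgeModel n X)` of HodgeConjectureFor, fed to `closes` as hM.
Shared summit item (HolomorphicDefect, AmpleAdicLefschetz, PeriodDeficiency, …); discharged in tree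
by Literature.AlgebraicGeometry.HodgeTheory.nonempty_hodgeModel_holds (Serre GAGA §2 analytification
+ de Rham + Voisin 2002 Prop. 6.11), so a prover closes it in one line from a Theorems file that
imports ComplexConjugationHolds (the route file deliberately does not). [difficulty: S]
[SerreGAGA1956, VoisinHodgeI2002] -/
@[route_item "route-HodgeConjecture-MilnorKExponential", crux]
def HodgeModelsExist : Prop :=
  ∀ (n : ℕ) (X : Literature.AlgebraicGeometry.Motives.SchemeOver ℂ), Literature.AlgebraicGeometry.Motives.IsSmoothProjective n X → Nonempty (Literature.AlgebraicGeometry.HodgeTheory.HodgeModel n X)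

/-- `HodgeModelsExist` holds: proved by `Summit.HodgeConjecture.HodgeConjecture.Theorems.genericDivisibility_hodgeModelsExist_proof` @ 8e7689d4c59e. -/
theorem HodgeModelsExist_holds : HodgeModelsExist := _root_.Summit.HodgeConjecture.HodgeConjecture.Theorems.genericDivisibility_hodgeModelsExist_proof

-- earlier AlgebraicClassesAreSymbolClasses (stmt-HodgeConjecture-17745, replaced 2026-08-17T02:56:12Z -> stmt-HodgeConjecture-18703): retired by None — ∀ ⦃n : ℕ⦄ ⦃X : Literature.AlgebraicGeometry.Motives.SchemeOver ℂ⦄, Literature.AlgebraicGeometry.Motives.IsSmoothProjective n X → ∀ (q : ℕ) (c : Literature.AlgebraicGeometry.HodgeTheory.complexBetti X (2 * (q + 1))), Literature.AlgebraicGeometry.Hodge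
/-- item stmt-HodgeConjecture-18703 · support · rank 9 · open · by planner
sources: doi:10.1007/s00222-008-0144-8, doi:10.1515/crll.1990.411.51, internal-2001-analytic-milnor-k-cohomology-ThmA
[support] REPAIRED AlgebraicClassesAreSymbolClasses (stmt-HodgeConjecture-17745 had the same
above-the-dimension vacuity as the refuted SymbolLift — 0 ∈ algebraicClasses X (q+1) is rational,
but no class is a symbol class when H^{2(q+1)}(X) = 0; witness X = ℙ⁰, q = 0, c = 0, refuter note R3
on stmt-17744 — so `q + 1 ≤ n` is inserted after `∀ (q : ℕ)`, as in SymbolLiftR). Alg^p ⊆ L^p for 1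
≤ p = q+1 ≤ dim X: every rational class in algebraicClasses X (q+1), q+1 ≤ n, is a symbol class of
weight q+1 (2001 Thm A: Bloch–Quillen–Kerz + the dlog/Koszul fundamental class; consistency of the
typing — its refutation means the normalisation/transgression conventions of the inlined
IsSymbolClass are wrong, not that the line is dead). [difficulty: L] -/
@[route_item "route-HodgeConjecture-MilnorKExponential"]
def AlgebraicClassesAreSymbolClasses : Prop :=
  ∀ ⦃n : ℕ⦄ ⦃X : Literature.AlgebraicGeometry.Motives.SchemeOver ℂ⦄, Literature.AlgebraicGeometry.Motives.IsSmoothProjective n X → ∀ (q : ℕ), q + 1 ≤ n → ∀ (c : Literature.AlgebraicGeometry.HodgeTheory.complexBetti X (2 * (q + 1))), Literature.AlgebraicGeometry.HodgeTheory.IsRationalClass c → c ∈ Literature.AlgebraicGeometry.HodgeTheory.algebraicClasses X (q + 1) → (∃ A : Literature.AlgebraicGeometry.HodgeTheory.HodgeModel n X, let F : ℕ → Type := fun k ↦ Literature.Geometry.Kaehler.MForm 𝓘(ℝ, A.model) A.carrier ℂ k; let CF := Literature.NumberTheory.Transcendental.cclosedSmoothForms A.model A.carrier (2 * q + 1 +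 1); let MK := Literature.NumberTheory.Transcendental.complexDeRhamCohomology.mk A.model A.carrier (2 * q + 1 + 1); let DR := A.deRham A.carrier (2 * q + 1 + 1); let T : Type := Fin (q + 1) → (A.carrier → ℂ); let IsU : Set A.carrier → (A.carrier → ℂ) → Prop := fun W f ↦ MDifferentiableOn 𝓘(ℂ, A.model) 𝓘(ℂ, ℂ) f W ∧ ∀ x ∈ W, f x ≠ 0; let Good : Set A.carrier → T → Prop := fun W t ↦ ∀ i, IsU W (t i); let Rel : Set A.carrier → AddSubgroup (T →₀ ℤ) := fun W ↦ AddSubgroup.closure ({s : T →₀ ℤ | ∃ t t' : T, Good W t ∧ Good W t' ∧ (∀ i, ∀ x ∈ W, t i x = t' i x) ∧ s = Finsupp.single t 1 - Finsupp.single t' 1} ∪ {s : T →₀ ℤ | ∃ (t : T) (i : Fin (q + 1)) (g : A.carrier → ℂ), Good W t ∧ IsU W g ∧ s = Finsupp.single (Function.update t i (t i * g)) 1 - Finsupp.single t 1 - Finsupp.single (Function.update t i g) 1} ∪ {s : T →₀ ℤ | ∃ (t : T) (i j : Fin (q + 1)), Good W t ∧ i ≠ j ∧ (∀ x ∈ W,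 t i x + t j x = 1) ∧ s = Finsupp.single t 1}); let DW : T → F (q + 1) := fun t ↦ Fin.hIterate (fun k : ℕ ↦ F k) (Literature.Geometry.Kaehler.MForm.ofFun 𝓘(ℝ, A.model) (fun _ : A.carrier ↦ (1 : ℂ))) (fun (i : Fin (q + 1)) (acc : F (i : ℕ)) ↦ Literature.Geometry.Kaehler.MForm.wedge acc (fun x : A.carrier ↦ (t i x)⁻¹ • Literature.Geometry.Kaehler.mextDeriv (Literature.Geometry.Kaehler.MForm.ofFun 𝓘(ℝ, A.model) (t i)) x)); let SF : (T →₀ ℤ) → F (q + 1) := fun σ ↦ Finsupp.sum σ fun (t : T) (z : ℤ) ↦ z • DW t; let Tr : (ι : Type) → (U : ι → Set A.carrier) → (∀ i, IsOpen (U i)) → ((Fin (q + 2) → ι) → F (q + 1)) → F (2 * q + 1 + 1) → Prop := fun ι U hU w θ ↦ ∃ Z : (a b : ℕ) → Literature.Geometry.Kaehler.CechForms 𝓘(ℝ, A.model) ℂ U a b, (∀ (J : Fin (q + 2) → ι), ∀ x ∈ Literature.Geometry.Kaehler.cechSet U J, ((Literature.Geometry.Kaehler.cechδ 𝓘(ℝ,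 A.model) ℂ hU q (q + 1) (Z q (q + 1)) J : F (q + 1)) x = w J x)) ∧ (∀ a b : ℕ, a + 1 + b = 2 * q + 1 → a < q → Literature.Geometry.Kaehler.cechd 𝓘(ℝ, A.model) ℂ hU (a + 1) b (Z (a + 1) b) = Literature.Geometry.Kaehler.cechδ 𝓘(ℝ, A.model) ℂ hU a (b + 1) (Z a (b + 1))) ∧ (∀ (J : Fin 1 → ι), ∀ x ∈ Literature.Geometry.Kaehler.cechSet U J, ((Literature.Geometry.Kaehler.cechd 𝓘(ℝ, A.model) ℂ hU 0 (2 * q + 1) (Z 0 (2 * q + 1)) J : F (2 * q + 1 + 1)) x = θ x)); (∃ (ι : Type) (_ : Fintype ι) (L : Literature.Geometry.Kaehler.HolomorphicLineBundle ι A.model A.carrier) (θ₀ : CF) (c₀ : Literature.AlgebraicGeometry.HodgeTheory.complexBetti X (2 * q + 1 + 1)), Tr ι L.baseSet L.isOpen_baseSet (fun J ↦ SF (Finsupp.single (fun i : Fin (q + 1) ↦ L.coordChange (J (Fin.castSucc i)) (J i.succ)) 1)) θ₀ ∧ Literature.AlgebraicGeometry.HodgeTheory.IsRationalClass c₀ ∧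 c₀ ≠ 0 ∧ DR (MK θ₀) = A.pullback (2 * q + 1 + 1) c₀) ∧ (∃ (ι : Type) (_ : Fintype ι) (U : ι → Set A.carrier) (hU : ∀ i, IsOpen (U i)) (_ : ∀ x, ∃ i, x ∈ U i) (σ : (Fin (q + 2) → ι) → (T →₀ ℤ)) (_ : ∀ J, ∀ t ∈ (σ J).support, Good (Literature.Geometry.Kaehler.cechSet U J) t) (_ : ∀ J' : Fin (q + 3) → ι, (∑ j : Fin (q + 3), ((-1 : ℤ) ^ (j : ℕ)) • σ (J' ∘ Fin.succAbove j)) ∈ Rel (Literature.Geometry.Kaehler.cechSet U J')) (θ : CF) (m : ℤ), m ≠ 0 ∧ Tr ι U hU (fun J ↦ SF (σ J)) θ ∧ DR (MK θ) = (m : ℂ) • A.pullback (2 * q + 1 + 1) c))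

-- earlier Assembly (stmt-HodgeConjecture-17747, replaced 2026-08-17T02:22:51Z -> stmt-HodgeConjecture-18178): retired by None — SymbolClassesAlgebraic → SymbolLift → HodgeConjecture
-- earlier Assembly (stmt-HodgeConjecture-18178, replaced 2026-08-17T02:57:22Z -> stmt-HodgeConjecture-18737): retired by None — HodgeModelsExist → SymbolClassesAlgebraic → SymbolLift → HodgeConjecture
/-- item stmt-HodgeConjecture-18737 · assembly · rank 1 · closed · proved by Summit.HodgeConjecture.HodgeConjecture.Theorems.milnorKExponential_assembly_proof @ 5f4491866a50 (prover) · by planner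
sources: Deligne2000, doi:10.1515/crll.1990.411.51
[assembly] HodgeModelsExist → SymbolClassesAlgebraic → SymbolLiftR → HodgeConjecture — exactly the
deciding theorem `closes` curried (pure logic: hM gives the anti-vacuity conjunct; p = 0 by
hodgeConjectureFor_codim_zero; p = q+1 ≤ n by SymbolLiftR then SymbolClassesAlgebraic; p > n: a
(p,p)-class in H^{2p} = 0 is zero, IsOfHodgeType.eq_zero_pp_of_lt + Submodule.zero_mem). Restated in
the refutation repair (SymbolLift, stmt-17744, refuted-misstated → SymbolLiftR = C′ with q+1 ≤ n);
provable from the route file alone (Sketch.lean: assemblyR_holds := closesR, axioms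
propext/choice/Quot.sound). [difficulty: S] [Deligne2000, doi:10.1515/crll.1990.411.51] -/
@[route_item "route-HodgeConjecture-MilnorKExponential"]
def Assembly : Prop :=
  HodgeModelsExist → SymbolClassesAlgebraic → SymbolLiftR → HodgeConjecture

-- `Assembly` holds: proved by `Summit.HodgeConjecture.HodgeConjecture.Theorems.milnorKExponential_assembly_proof` @ 5f4491866a50 (its module imports this route file, so no `_holds` link can be stated here).

-- records of items no longer active in this route (dropped / restated):
-- earlier SymbolLift (stmt-HodgeConjecture-17744, dropped 2026-08-17T02:58:25Z): refuted by Summit.HodgeConjecture.HodgeConjecture.Theorems.MilnorKExponentialSymbolLift_refuted @ 45f07759507b — ∀ ⦃n : ℕ⦄ ⦃X : Literature.AlgebraicGeometry.Motives.SchemeOver ℂ⦄, Literature.AlgebraicGeometry.Motives.IsSmoothProjective n X → ∀ (q : ℕ) (c : Literature.AlgebraicGeometry.HodgeTheory.complexBetti X (2 * (q 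

/-! D-0027 §2.1 — DECIDING THEOREM (planner-authored via `route open/edit --closes-file`; by planner-rfix-HodgeConjecture-MilnorKExponent-fbe2b952-0 2026-08-17T02:57:22Z):
its hypotheses are this route's items and its conclusion the sub-problem Statement (glue_lint), and it elaborates with this file. -/

@[closes "route-HodgeConjecture-MilnorKExponential"] theorem closes (hM : HodgeModelsExist) (hGK : SymbolClassesAlgebraic) (hLift : SymbolLiftR) : _root_.HodgeConjecture := by
  intro n X hX
  refine ⟨hM n X hX, fun p c hc hpp ↦ ?_⟩
  cases p with
  | zero => exact Literature.AlgebraicGeometry.HodgeTheory.hodgeConjectureFor_codim_zero c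
  | succ q =>
    rcases le_or_gt (q + 1) n with hq | hq
    · exact hGK hX q c hc (hLift hX q hq c hc hpp)
    · rw [Literature.AlgebraicGeometry.HodgeTheory.IsOfHodgeType.eq_zero_pp_of_lt hpp hq]
      exact Submodule.zero_mem _

end Summit.HodgeConjecture.HodgeConjecture.Theses.MilnorKExponential
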